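import Summits.CriticalPhenomena.SAWScalingLimit.Theorems.SAWDevelopingMapHexTransferSimilarityIdentification
import Summits.CriticalPhenomena.SAWScalingLimit.Theorems.SAWDevelopingMapHexTransferPortTransferWeakLimit
import Summits.CriticalPhenomena.SAWScalingLimit.Theorems.SAWDevelopingMapHexTransferConjugateRotationCovariance
import Literature.Probability.RandomPlanarGeometry.YangBaxterSAWLaw
import Literature.Probability.RandomPlanarGeometry.HexSAW
import Literature.Probability.RandomPlanarGeometry.WeaklySAW
import Summits.CriticalPhenomena.SAWScalingLimit.Theorems.SAWDevelopingMapHexTransferYbRelayDefs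
import HarnessLib

/-!
# Crux `HexTransfer` (stmt-CriticalPhenomena-14221), line `yb-relay`: stub `stub_dictionaryGlue`

Landing target: `Summits/CriticalPhenomena/SAWScalingLimit/Theorems/SAWDevelopingMapHexTransferDictionaryGlue.lean`
(`--supports stmt-CriticalPhenomena-14221`).

The glue of the line's convention bridge at the hexagonal end: IF at `Θ ≡ π/3` the critical
Glazman–Manolescu law from boundary mid-edges is the push-forward of the critical hexagonal SAW law
of the face domain along a map of walks whose drawn curves are `2δ`-close to the `S_δ`-image of the
honeycomb polylines (`stub_gmHexDictionary`, exact, finite mesh), AND the critical hexagonal SAW laws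
of the face domains of `D` converge in law to chordal SLE(8/3) in `S₀⁻¹ D` (`stub_hexFaceRobust`'s
conclusion; `S₀ z = i z`, `S_δ z = i z − iδ/2`), THEN the `π/3` Yang–Baxter law converges in law to
chordal SLE(8/3) in `D`. Pure bookkeeping: similarity covariance of SLE (`isSLECurve_map_similarity`),
push-forward of the hexagonal limit along `S₀` (`tendstoLaw_comp_continuous`), the two drawings are
`(5/2)δ`-close (`2δ` from the dictionary, `δ/2` between `S_δ` and `S₀`), converging together
(`tendstoLaw_of_dist_le`), and the law identity transports the test integrals (`integral_map`).
-/

noncomputable section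

namespace Summit.CriticalPhenomena.SAWScalingLimit.Cruxes.HexTransfer.YbRelay

open MeasureTheory Filter Topology Set
open scoped NNReal ENNReal BoundedContinuousFunction
open Complex (I I_ne_zero)
open Literature.Probability.RandomPlanarGeometry
open Literature.Probability.RandomPlanarGeometry.SAW
open Literature.Probability.RandomPlanarGeometry.SAW.YangBaxter
open Literature.Probability.LatticeModels (Site HexVertex hexGraph hexCenter)
open Literature.Probability (Process.preWienerMeasure)


/-! ### Small lemmas -/

/-- Two push-forwards of one curve class along maps at uniform distance `≤ C` are at distance `≤ C`
(take the same parametrisation on both sides). [folklore] -/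
theorem dist_curveClassMap_map_le {f g : C(ℂ, ℂ)} {C : ℝ} (hC : 0 ≤ C)
    (h : ∀ z, dist (f z) (g z) ≤ C) (c : CurveClass ℂ) :
    dist (CurveClass.map f c) (CurveClass.map g c) ≤ C := by
  obtain ⟨γ, rfl⟩ := CurveClass.surjective_mk c
  rw [CurveClass.map_mk, CurveClass.map_mk, CurveClass.dist_mk_mk]
  refine (Curve.dist_le_dist_toContinuousMap _ _).trans ((ContinuousMap.dist_le hC).2 fun t => ?_)
  exact h (γ t)

/-- `S_δ` and `S₀` differ by the translation `−iδ/2`, of length `|δ|/2`. [folklore] -/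
theorem dist_gmSimilarity_similarity (δ : ℝ) (z : ℂ) :
    dist (gmSimilarity δ z) (similarity I I_ne_zero 0 z) ≤ |δ| / 2 := by
  simp only [gmSimilarity, similarity_apply, add_zero, dist_eq_norm, add_sub_cancel_left, norm_neg,
    norm_div, Complex.norm_mul, Complex.norm_I, Complex.norm_real, one_mul, Real.norm_eq_abs]
  norm_num

/-- The hexagonal SAW law is `0` or a probability measure. [folklore] -/
theorem hexSAWLaw_dichotomy (Ω : Set ℂ) (δ : ℝ) (v w : HexVertex) :
    hexSAWLaw Ω δ v w = 0 ∨ IsProbabilityMeasure (hexSAWLaw Ω δ v w) :=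
  Literature.Probability.RandomPlanarGeometry.WeaklySAW.normalize_dichotomy _

/-- Mid-edge endpoint approximations of the two (distinct) marked points are eventually distinct.
[folklore] -/
theorem eventually_ne_of_isYBEndpointApprox {Θ : ℤ → ℝ} {D : DobrushinDomain}
    {a b : ℝ → MidEdge} (h : IsYBEndpointApprox Θ D a b) : ∀ᶠ δ in 𝓝[>] (0 : ℝ), a δ ≠ b δ := by
  have hab : D.pt 0 ≠ D.pt 1 := fun h => absurd (D.pt_injective h) (by decide)
  obtain ⟨U, V, hU, hV, hpU, hpV, hUV⟩ := t2_separation hab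
  filter_upwards [h.tendsto_fst (hU.mem_nhds hpU), h.tendsto_snd (hV.mem_nhds hpV)] with δ ha hb
  intro hab'
  have ha' : (δ : ℂ) * planeMidpoint Θ (b δ) ∈ U := by
    have ha'' : (δ : ℂ) * planeMidpoint Θ (a δ) ∈ U := ha
    rwa [hab'] at ha''
  exact Set.disjoint_left.1 hUV ha' hb

/-! ### The glue -/

/-- **Dictionary + face-domain convergence ⇒ DCS Conjecture 1 in Glazman–Manolescu's `π/3` encoding**
(registered stub `stub_dictionaryGlue` of line `yb-relay`, crux stmt-CriticalPhenomena-14221): for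
every Dobrushin domain and every `π/3` endpoint approximation through boundary edges, the critical
Yang–Baxter law of `H(π/3)` converges in law to chordal SLE(8/3). [folklore] -/
theorem stub_dictionaryGlue : (∀ (Ω : Set ℂ) (δ : ℝ), 0 < δ → ∀ a b : MidEdge, a ≠ b → IsBdryEdge (meshFaces third Ω δ) a → IsBdryEdge (meshFaces third Ω δ) b → Nonempty (YangBaxterSAW third Ω δ a b) → ∃ φ : HexDomainSAW (faceDomain Ω δ a) δ (bdryVertex (meshFaces third Ω δ) a) (bdryVertex (meshFaces third Ω δ) b) → YangBaxterSAW third Ω δ a b, ybLaw third Ω δ 1 a b = (hexSAWLaw (faceDomain Ω δ a) δ (bdryVertex (meshFaces third Ω δ) a) (bdryVertex (meshFaces third Ω δ) b)).map φ ∧ ∀ γ, dist ((φ γ).curve third δ) (CurveClass.map (gmSimilarity δ : C(ℂ, ℂ)) γ.curve) ≤ 2 * δ) → (∀ (D : DobrushinDomain) (a b : ℝ → MidEdge), IsYBEndpointApprox third D a b → (∀ᶠ δ in 𝓝[>] (0 : ℝ), IsBdryEdge (meshFaces third D.carrier δ) (a δ) ∧ IsBdryEdge (meshFaces third D.carrier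 δ) (b δ)) → ConvergesInLawToSLE ((8 : ℝ≥0) / 3) (D.map (similarity I I_ne_zero 0).symm) (fun δ (γ : HexDomainSAW (faceDomain D.carrier δ (a δ)) δ (bdryVertex (meshFaces third D.carrier δ) (a δ)) (bdryVertex (meshFaces third D.carrier δ) (b δ))) => γ.curve) (fun δ => hexSAWLaw (faceDomain D.carrier δ (a δ)) δ (bdryVertex (meshFaces third D.carrier δ) (a δ)) (bdryVertex (meshFaces third D.carrier δ) (b δ)))) → ∀ (D : DobrushinDomain) (a b : ℝ → MidEdge), IsYBEndpointApprox third D a b → (∀ᶠ δ in 𝓝[>] (0 : ℝ), IsBdryEdge (meshFaces third D.carrier δ) (a δ) ∧ IsBdryEdge (meshFaces third D.carrier δ) (b δ)) → ConvergesInLawToSLE ((8 : ℝ≥0) / 3) D (fun δ (γ : YangBaxterSAW third D.carrier δ (a δ) (b δ)) => γ.curve third δ) (fun δ => ybLaw third D.carrier δ 1 (a δ) (b δ)) := by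
  classical
  intro hD hR D a b hab hbd
  haveI := isProbabilityMeasure_preWienerMeasure'
  obtain ⟨Γ, hΓ, -, hT⟩ := hR D a b hab hbd
  set S₀ : ℂ ≃ₜ ℂ := similarity I I_ne_zero 0 with hS₀
  -- the rotated SLE curve lives in `D`
  have hΓ' : IsSLECurve ((8 : ℝ≥0) / 3) D (CurveClass.map (S₀ : C(ℂ, ℂ)) ∘ Γ) := by
    have h := PinTheShear.isSLECurve_map_similarity (D.map S₀.symm) I I_ne_zero 0 hΓ
    rwa [PinTheShear.markedDomain_map_symm_map] at h
  refine ⟨_, hΓ', Eventually.of_forall fun δ => YBWalk.aemeasurable_curve _ _ δ 1 _ _, ?_⟩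
  -- abbreviations for the hexagonal side
  let Δ : ℝ → Set Face := fun δ => meshFaces third D.carrier δ
  let H : ℝ → Type := fun δ =>
    HexDomainSAW (faceDomain D.carrier δ (a δ)) δ (bdryVertex (Δ δ) (a δ)) (bdryVertex (Δ δ) (b δ))
  let P : ∀ δ, Measure (H δ) := fun δ =>
    hexSAWLaw (faceDomain D.carrier δ (a δ)) δ (bdryVertex (Δ δ) (a δ)) (bdryVertex (Δ δ) (b δ))
  -- the good set of meshes, and the dictionary map on it
  let good : ℝ → Prop := fun δ => 0 < δ ∧ a δ ≠ b δ ∧ IsBdryEdge (Δ δ) (a δ) ∧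
    IsBdryEdge (Δ δ) (b δ) ∧ Nonempty (YangBaxterSAW third D.carrier δ (a δ) (b δ))
  have hgood : ∀ᶠ δ in 𝓝[>] (0 : ℝ), good δ := by
    filter_upwards [self_mem_nhdsWithin, eventually_ne_of_isYBEndpointApprox hab, hbd, hab.nonempty] with δ h0 hne hb hn
    exact ⟨h0, hne, hb.1, hb.2, hn⟩
  let φ : ∀ δ, good δ → H δ → YangBaxterSAW third D.carrier δ (a δ) (b δ) := fun δ h =>
    Classical.choose (hD D.carrier δ h.1 (a δ) (b δ) h.2.1 h.2.2.1 h.2.2.2.1 h.2.2.2.2)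
  have hφ : ∀ δ (h : good δ), ybLaw third D.carrier δ 1 (a δ) (b δ) = (P δ).map (φ δ h) ∧
      ∀ γ, dist ((φ δ h γ).curve third δ) (CurveClass.map (gmSimilarity δ : C(ℂ, ℂ)) γ.curve) ≤
        2 * δ :=
    fun δ h => Classical.choose_spec (hD D.carrier δ h.1 (a δ) (b δ) h.2.1 h.2.2.1 h.2.2.2.1 h.2.2.2.2)
  -- the two observables on the hexagonal side
  let Y : ∀ δ, H δ → CurveClass ℂ := fun δ γ =>
    if h : good δ then (φ δ h γ).curve third δ
    else CurveClass.map (gmSimilarity δ : C(ℂ, ℂ)) γ.curve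
  let Y' : ∀ δ, H δ → CurveClass ℂ := fun δ γ => CurveClass.map (S₀ : C(ℂ, ℂ)) γ.curve
  -- (1) the rotated hexagonal curves converge to the rotated SLE
  have h1 : TendstoLaw Y' P (CurveClass.map (S₀ : C(ℂ, ℂ)) ∘ Γ) Process.preWienerMeasure :=
    PinTheShear.tendstoLaw_comp_continuous hT
      ⟨CurveClass.map (S₀ : C(ℂ, ℂ)), (CurveClass.lipschitzWith_map (lipschitzWith_similarity I I_ne_zero 0)).continuous⟩
  -- (2) the two observables are `(5/2)|δ|`-close
  have h2 : ∀ δ γ, dist (Y δ γ) (Y' δ γ) ≤ 5 / 2 * |δ| := by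
    intro δ γ
    have hB : dist (CurveClass.map (gmSimilarity δ : C(ℂ, ℂ)) γ.curve) (Y' δ γ) ≤ |δ| / 2 :=
      dist_curveClassMap_map_le (by positivity) (dist_gmSimilarity_similarity δ) _
    by_cases h : good δ
    · have hA := (hφ δ h).2 γ
      have hδ : (2 : ℝ) * δ ≤ 2 * |δ| := by nlinarith [le_abs_self δ]
      simp only [Y, dif_pos h]
      linarith [dist_triangle ((φ δ h γ).curve third δ)
        (CurveClass.map (gmSimilarity δ : C(ℂ, ℂ)) γ.curve) (Y' δ γ)]
    · simp only [Y, dif_neg h]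
      linarith [abs_nonneg δ]
  -- (3) converging together
  have h3 : TendstoLaw Y P (CurveClass.map (S₀ : C(ℂ, ℂ)) ∘ Γ) Process.preWienerMeasure := by
    refine Sketch.PortTransfer.tendstoLaw_of_dist_le (fun δ => hexSAWLaw_dichotomy _ _ _ _)
      (fun δ => (EmbDomainSAW.measurable_of_top _).aemeasurable)
      (fun δ => (EmbDomainSAW.measurable_of_top _).aemeasurable)
      ((measurable_curveClassMap_similarity I I_ne_zero 0).comp_aemeasurable hΓ.aemeasurable)
      (ε := fun δ => 5 / 2 * |δ|) ?_ h2 h1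
    have : Tendsto (fun δ : ℝ => 5 / 2 * |δ|) (𝓝 0) (𝓝 (5 / 2 * |0|)) :=
      (continuous_const.mul continuous_abs).tendsto 0
    rw [abs_zero, mul_zero] at this
    exact this.mono_left nhdsWithin_le_nhds
  -- (4) transport the test integrals along the law identity
  intro f
  refine (h3 f).congr' ?_
  filter_upwards [hgood] with δ h
  have hmeas : AEStronglyMeasurable (fun γ : YangBaxterSAW third D.carrier δ (a δ) (b δ) =>
      f (γ.curve third δ)) ((P δ).map (φ δ h)) :=
    (YBWalk.measurable_of_top _).aestronglyMeasurable
  rw [(hφ δ h).1, integral_map (EmbDomainSAW.measurable_of_top _).aemeasurable hmeas]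
  refine integral_congr_ae (Eventually.of_forall fun γ => ?_)
  simp only [Y, dif_pos h]


/-! ### The glue, one endpoint approximation at a time

Appended 2026-08-17 (line lead c4, skeleton v5): the composition of line `yb-relay` only needs the
`π/3` Yang–Baxter limit for ONE boundary endpoint approximation per domain, so the research stub is
re-typed in the weaker `∃`-form (`HexSAWScalingLimit → ∀ D, ∃ a b, …`); the glue is therefore needed
for a fixed triple `(D, a, b)`. Same proof as `stub_dictionaryGlue` with the face-domain convergence
taken as a hypothesis at `(D, a, b)` instead of for all triples. -/

/-- **Dictionary + face-domain convergence at `(D, a, b)` ⇒ the `π/3` Yang–Baxter law of `(D, a, b)`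
converges to chordal SLE(8/3)** (pointwise form of `stub_dictionaryGlue`): if at `Θ ≡ π/3` the critical
Glazman–Manolescu law from boundary mid-edges is the push-forward of the critical hexagonal SAW law of
the face domain along a `2δ`-close map of walks (the exact dictionary), and the hexagonal laws of the
face domains of `D` along the boundary approximation `(a, b)` converge in law to chordal SLE(8/3) in
`S₀⁻¹ D` (`S₀ z = i z`), then `ybLaw (π/3)` of `(D, a, b)` converges in law to chordal SLE(8/3) in `D`.
[folklore] -/
theorem ybThirdSLE_of_faceSLE_at : ∀ (hD : ∀ (Ω : Set ℂ) (δ : ℝ), 0 < δ → ∀ a b : MidEdge, a ≠ b → IsBdryEdge (meshFaces third Ω δ) a → IsBdryEdge (meshFaces third Ω δ) b → Nonempty (YangBaxterSAW third Ω δ a b) → ∃ φ : HexDomainSAW (faceDomain Ω δ a) δ (bdryVertex (meshFaces third Ω δ) a) (bdryVertex (meshFaces third Ω δ) b) → YangBaxterSAW third Ω δ a b, ybLaw third Ω δ 1 a b = (hexSAWLaw (faceDomain Ω δ a) δ (bdryVertex (meshFaces third Ω δ) a) (bdryVertex (meshFaces third Ω δ) b)).map φ ∧ ∀ γ, dist ((φ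 γ).curve third δ) (CurveClass.map (gmSimilarity δ : C(ℂ, ℂ)) γ.curve) ≤ 2 * δ) (D : DobrushinDomain) (a b : ℝ → MidEdge) (hab : IsYBEndpointApprox third D a b) (hbd : ∀ᶠ δ in 𝓝[>] (0 : ℝ), IsBdryEdge (meshFaces third D.carrier δ) (a δ) ∧ IsBdryEdge (meshFaces third D.carrier δ) (b δ)) (hconv : ConvergesInLawToSLE ((8 : ℝ≥0) / 3) (D.map (similarity I I_ne_zero 0).symm) (fun δ (γ : HexDomainSAW (faceDomain D.carrier δ (a δ)) δ (bdryVertex (meshFaces third D.carrier δ) (a δ)) (bdryVertex (meshFaces third D.carrier δ) (b δ))) => γ.curve) (fun δ => hexSAWLaw (faceDomain D.carrier δ (a δ)) δ (bdryVertex (meshFaces third D.carrier δ) (a δ)) (bdryVertex (meshFaces third D.carrier δ) (b δ)))), ConvergesInLawToSLE ((8 : ℝ≥0) / 3) D (fun δ (γ : YangBaxterSAW third D.carrier δ (a δ) (b δ)) => γ.curve third δ) (fun δ => ybLaw third D.carrier δ 1 (a δ) (b δ)) := by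
  intro hD D a b hab hbd hconv
  classical
  haveI := isProbabilityMeasure_preWienerMeasure'
  obtain ⟨Γ, hΓ, -, hT⟩ := hconv
  set S₀ : ℂ ≃ₜ ℂ := similarity I I_ne_zero 0 with hS₀
  -- the rotated SLE curve lives in `D`
  have hΓ' : IsSLECurve ((8 : ℝ≥0) / 3) D (CurveClass.map (S₀ : C(ℂ, ℂ)) ∘ Γ) := by
    have h := PinTheShear.isSLECurve_map_similarity (D.map S₀.symm) I I_ne_zero 0 hΓ
    rwa [PinTheShear.markedDomain_map_symm_map] at h
  refine ⟨_, hΓ', Eventually.of_forall fun δ => YBWalk.aemeasurable_curve _ _ δ 1 _ _, ?_⟩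
  -- abbreviations for the hexagonal side
  let Δ : ℝ → Set Face := fun δ => meshFaces third D.carrier δ
  let H : ℝ → Type := fun δ =>
    HexDomainSAW (faceDomain D.carrier δ (a δ)) δ (bdryVertex (Δ δ) (a δ)) (bdryVertex (Δ δ) (b δ))
  let P : ∀ δ, Measure (H δ) := fun δ =>
    hexSAWLaw (faceDomain D.carrier δ (a δ)) δ (bdryVertex (Δ δ) (a δ)) (bdryVertex (Δ δ) (b δ))
  -- the good set of meshes, and the dictionary map on it
  let good : ℝ → Prop := fun δ => 0 < δ ∧ a δ ≠ b δ ∧ IsBdryEdge (Δ δ) (a δ) ∧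
    IsBdryEdge (Δ δ) (b δ) ∧ Nonempty (YangBaxterSAW third D.carrier δ (a δ) (b δ))
  have hgood : ∀ᶠ δ in 𝓝[>] (0 : ℝ), good δ := by
    filter_upwards [self_mem_nhdsWithin, eventually_ne_of_isYBEndpointApprox hab, hbd, hab.nonempty] with δ h0 hne hb hn
    exact ⟨h0, hne, hb.1, hb.2, hn⟩
  let φ : ∀ δ, good δ → H δ → YangBaxterSAW third D.carrier δ (a δ) (b δ) := fun δ h =>
    Classical.choose (hD D.carrier δ h.1 (a δ) (b δ) h.2.1 h.2.2.1 h.2.2.2.1 h.2.2.2.2)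
  have hφ : ∀ δ (h : good δ), ybLaw third D.carrier δ 1 (a δ) (b δ) = (P δ).map (φ δ h) ∧
      ∀ γ, dist ((φ δ h γ).curve third δ) (CurveClass.map (gmSimilarity δ : C(ℂ, ℂ)) γ.curve) ≤
        2 * δ :=
    fun δ h => Classical.choose_spec (hD D.carrier δ h.1 (a δ) (b δ) h.2.1 h.2.2.1 h.2.2.2.1 h.2.2.2.2)
  -- the two observables on the hexagonal side
  let Y : ∀ δ, H δ → CurveClass ℂ := fun δ γ =>
    if h : good δ then (φ δ h γ).curve third δ
    else CurveClass.map (gmSimilarity δ : C(ℂ, ℂ)) γ.curve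
  let Y' : ∀ δ, H δ → CurveClass ℂ := fun δ γ => CurveClass.map (S₀ : C(ℂ, ℂ)) γ.curve
  -- (1) the rotated hexagonal curves converge to the rotated SLE
  have h1 : TendstoLaw Y' P (CurveClass.map (S₀ : C(ℂ, ℂ)) ∘ Γ) Process.preWienerMeasure :=
    PinTheShear.tendstoLaw_comp_continuous hT
      ⟨CurveClass.map (S₀ : C(ℂ, ℂ)), (CurveClass.lipschitzWith_map (lipschitzWith_similarity I I_ne_zero 0)).continuous⟩
  -- (2) the two observables are `(5/2)|δ|`-close
  have h2 : ∀ δ γ, dist (Y δ γ) (Y' δ γ) ≤ 5 / 2 * |δ| := by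
    intro δ γ
    have hB : dist (CurveClass.map (gmSimilarity δ : C(ℂ, ℂ)) γ.curve) (Y' δ γ) ≤ |δ| / 2 :=
      dist_curveClassMap_map_le (by positivity) (dist_gmSimilarity_similarity δ) _
    by_cases h : good δ
    · have hA := (hφ δ h).2 γ
      have hδ : (2 : ℝ) * δ ≤ 2 * |δ| := by nlinarith [le_abs_self δ]
      simp only [Y, dif_pos h]
      linarith [dist_triangle ((φ δ h γ).curve third δ)
        (CurveClass.map (gmSimilarity δ : C(ℂ, ℂ)) γ.curve) (Y' δ γ)]
    · simp only [Y, dif_neg h]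
      linarith [abs_nonneg δ]
  -- (3) converging together
  have h3 : TendstoLaw Y P (CurveClass.map (S₀ : C(ℂ, ℂ)) ∘ Γ) Process.preWienerMeasure := by
    refine Sketch.PortTransfer.tendstoLaw_of_dist_le (fun δ => hexSAWLaw_dichotomy _ _ _ _)
      (fun δ => (EmbDomainSAW.measurable_of_top _).aemeasurable)
      (fun δ => (EmbDomainSAW.measurable_of_top _).aemeasurable)
      ((measurable_curveClassMap_similarity I I_ne_zero 0).comp_aemeasurable hΓ.aemeasurable)
      (ε := fun δ => 5 / 2 * |δ|) ?_ h2 h1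
    have : Tendsto (fun δ : ℝ => 5 / 2 * |δ|) (𝓝 0) (𝓝 (5 / 2 * |0|)) :=
      (continuous_const.mul continuous_abs).tendsto 0
    rw [abs_zero, mul_zero] at this
    exact this.mono_left nhdsWithin_le_nhds
  -- (4) transport the test integrals along the law identity
  intro f
  refine (h3 f).congr' ?_
  filter_upwards [hgood] with δ h
  have hmeas : AEStronglyMeasurable (fun γ : YangBaxterSAW third D.carrier δ (a δ) (b δ) =>
      f (γ.curve third δ)) ((P δ).map (φ δ h)) :=
    (YBWalk.measurable_of_top _).aestronglyMeasurable
  rw [(hφ δ h).1, integral_map (EmbDomainSAW.measurable_of_top _).aemeasurable hmeas]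
  refine integral_congr_ae (Eventually.of_forall fun γ => ?_)
  simp only [Y, dif_pos h]

end Summit.CriticalPhenomena.SAWScalingLimit.Cruxes.HexTransfer.YbRelay

end
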